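import Summits.AtomisticToContinuum.FouriersLaw.Theorems.VanishingNoiseTransferVanishingNoiseBoundUniformExpConvergenceTransfer
import Summits.AtomisticToContinuum.FouriersLaw.Theorems.VanishingNoiseTransferVanishingNoiseBoundUniformHarris
import Summits.AtomisticToContinuum.FouriersLaw.Theorems.VanishingNoiseTransferVanishingNoiseBoundUniformMinorization
import Summits.AtomisticToContinuum.FouriersLaw.Theorems.VanishingNoiseTransferVanishingNoiseBoundUniformLyapunov

/-!
# Stub S2a `stub_uniformAsymmetryTransfer` of the line `fekete-usc-one-length` (crux
`VanishingNoiseBound`, stmt-AtomisticToContinuum-11976): the uniform asymmetry transfer (UA)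

`--supports stmt-AtomisticToContinuum-11976`. The registered stub (UA): for `pinnedChain ω₂ lam β γ`
(all parameters `> 0`), `T > 0`, a length `N` and THE unique deterministic weak steady family
`μ0`, constants `K, ε₀, δ₀ > 0` such that for every bias `0 < |δ| < δ₀`, every `A ≥ 0` bounding
the flip-odd part of `μ0 (T+δ/2) (T-δ/2)` on continuous `|h| ≤ e^{θ_δ H}` and every flip rate
`ε ∈ (0, ε₀]`, SOME weak flip steady state of `L + εS` at `(T+δ/2, T-δ/2)` has total current within
`K ε A` of that of `μ0 (T+δ/2) (T-δ/2)` — the landed fixed-temperature transfer bound with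
constants UNIFORM in the bias. Proof (all inputs landed in the sibling `…VanishingNoiseBound*`
helper files):

* `uniformExpConvergence` — **(UEC)**: CEHR (2.5) for the flip-free transition kernels with
  constants `(C, c)` uniform for the temperatures `(T+δ/2, T-δ/2)`, `|δ| < T`, at the weight
  `θ = 1/(4T)`: the temperature-uniform Lyapunov threshold
  (`pinnedChain_lintegral_exp_hamiltonian_small_uniform`, `Tmax = 3T/2`) gives the drift
  `P_1 e^{θH} ≤ ½ e^{θH} + b` with one `b`; the temperature-uniform minorisation
  (`pinnedChain_minorization_uniform`, amplitudes in `[√(γT), √(3γT)]`) gives one time `m` and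
  weight `α` on the Harris sublevel set; Harris with explicit constants
  (`expConvergence_of_drift_of_minorization`) gives `(C, c)`.
* `stub_uniformAsymmetryTransfer` — (UA) from (UEC) by
  `uniformAsymmetryTransfer_of_uniformExpConvergence` (`N = 0`: no current).

No definitions, no `sorry`.
-/

noncomputable section

namespace Summit.AtomisticToContinuum.FouriersLaw.Theorems.FixedLengthNoiseContinuity

open MeasureTheory ProbabilityTheory Filter Topology Set
open scoped NNReal ENNReal
open Literature.MathematicalPhysics.KineticTheory.HeatConduction
open Literature.Probability.Process

variable {ω₂ lam β γ : ℝ} {N : ℕ}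

/-- **(UEC): exponential convergence of the flip-free chain with constants uniform near
equilibrium.** For `pinnedChain ω₂ lam β γ` (all parameters `> 0`), `N ≥ 2` and `T > 0`: with
`θ = 1/(4T)`, `δ₀ = T`, there are `C ≥ 0`, `c > 0` such that for every `|δ| < T`, at the
temperatures `(T+δ/2, T-δ/2)`, every invariant probability measure `μ` of the transition kernels
satisfies `|P_t f(z) - μ(f)| ≤ C e^{θH(z)} e^{-ct}` for all `z`, `t ≥ 0`, continuous `|f| ≤ e^{θH}`
(in the packaging consumed by `uniformAsymmetryTransfer_of_uniformExpConvergence`). -/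
theorem uniformExpConvergence (hω : 0 < ω₂) (hl : 0 < lam) (hβ : 0 < β) (hγ : 0 < γ) (hN : 1 < N)
    {T : ℝ} (hT : 0 < T) :
    ∃ θ δ₀ C c : ℝ, 0 < θ ∧ 0 < δ₀ ∧ δ₀ ≤ T ∧ θ * (2 * T + δ₀) ≤ 1 ∧ 0 ≤ C ∧ 0 < c ∧
      ∀ δ : ℝ, |δ| < δ₀ →
        ∀ μ : Measure (PhaseSpace N), IsProbabilityMeasure μ →
          (∀ t : ℝ≥0, μ.bind ((pinnedChain ω₂ lam β γ).transitionKernel N (T + δ / 2) (T - δ / 2) t) = μ) →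
          ∀ (z : PhaseSpace N) (t : ℝ≥0) (f : PhaseSpace N → ℝ), Continuous f →
            (∀ y, |f y| ≤ Real.exp (θ * (pinnedChain ω₂ lam β γ).hamiltonian N y)) →
            |∫ y, f y ∂((pinnedChain ω₂ lam β γ).transitionKernel N (T + δ / 2) (T - δ / 2) t z) -
                ∫ y, f y ∂μ| ≤
              C * Real.exp (θ * (pinnedChain ω₂ lam β γ).hamiltonian N z) * Real.exp (-c * t) := by
  set P := pinnedChain ω₂ lam β γ with hP
  have hN0 : 0 < N := by omega
  -- the weight and the temperature range
  set θ : ℝ := 1 / (4 * T) with hθ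
  have hθ0 : 0 < θ := by positivity
  set Tmax : ℝ := 3 * T / 2 with hTmax
  have hTmax0 : 0 < Tmax := by positivity
  have hθT : θ * Tmax = 3 / 8 := by rw [hθ, hTmax]; field_simp; ring
  have hθ' : θ < 1 / Tmax := by rw [lt_div_iff₀ hTmax0, hθT]; norm_num
  set Λ : ℝ := θ * γ * (Tmax + Tmax) with hΛ
  have hΛ0 : 0 ≤ Λ := by positivity
  -- (UH2): the uniform Lyapunov threshold at `t⋆ = 1`, and the drift constants `a = 1/2`, `b`
  obtain ⟨E₀, hE₀⟩ := pinnedChain_lintegral_exp_hamiltonian_small_uniform hω hl hβ hγ hN hθ0 hTmax0 hθ'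
    one_pos
  set b : ℝ := Real.exp Λ * Real.exp (θ * E₀) with hb
  have hb0 : 0 ≤ b := by positivity
  -- (UMin): the uniform minorisation on the Harris sublevel set `{e^{θH} ≤ R}`, `R = 8b + 2`
  set Rr : ℝ := (2 * (b / (1 - 1 / 2)) + 1) / (1 - 1 / 2) with hRr
  have hRr0 : 0 < Rr := by rw [hRr]; norm_num; positivity
  set cmin : ℝ := Real.sqrt (2 * γ * (T / 2)) with hcmin
  set cmax : ℝ := Real.sqrt (2 * γ * Tmax) with hcmax
  have hcmin0 : 0 < cmin := Real.sqrt_pos.2 (by positivity)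
  have hcle : cmin ≤ cmax := Real.sqrt_le_sqrt (by rw [hTmax]; nlinarith)
  obtain ⟨m, α, hm, hα, hmin⟩ := pinnedChain_minorization_uniform hω hl.le hβ hγ hN0 (Real.log Rr / θ) hcmin0 hcle
  -- Harris with explicit constants
  obtain ⟨C, c, hC, hc, h25⟩ := expConvergence_of_drift_of_minorization (ω₂ := ω₂) (lam := lam) (β := β)
    (γ := γ) (N := N) hω hl.le hβ hγ hN0 hθ0 (a := 1 / 2) (b := b) (by norm_num) (by norm_num) hb0 hα hm hΛ0
  refine ⟨θ, T, C, c, hθ0, hT, le_rfl, ?_, hC.le, hc, fun δ hδ μ hμ hinv z t f hf hfb => ?_⟩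
  · rw [hθ]; field_simp; norm_num
  -- the temperatures `(T+δ/2, T-δ/2)`, `|δ| < T`
  have hδ' := abs_lt.1 hδ
  set T_L : ℝ := T + δ / 2 with hTL
  set T_R : ℝ := T - δ / 2 with hTR
  have hTL0 : 0 < T_L := by rw [hTL]; linarith
  have hTR0 : 0 < T_R := by rw [hTR]; linarith
  have hTLle : T_L ≤ Tmax := by rw [hTL, hTmax]; linarith
  have hTRle : T_R ≤ Tmax := by rw [hTR, hTmax]; linarith
  have hTLge : T / 2 ≤ T_L := by rw [hTL]; linarith
  have hTRge : T / 2 ≤ T_R := by rw [hTR]; linarith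
  have hmax0 : 0 < max T_L T_R := lt_max_of_lt_left hTL0
  have hθ'τ : θ < 1 / max T_L T_R := hθ'.trans_le (one_div_le_one_div_of_le hmax0 (max_le hTLle hTRle))
  have hΛτ : θ * γ * (T_L + T_R) ≤ Λ :=
    mul_le_mul_of_nonneg_left (add_le_add hTLle hTRle) (by positivity)
  have hamp : ∀ T' : ℝ, T / 2 ≤ T' → T' ≤ Tmax →
      cmin ≤ Real.sqrt (2 * γ * T') ∧ Real.sqrt (2 * γ * T') ≤ cmax := fun T' h1 h2 =>
    ⟨Real.sqrt_le_sqrt (by nlinarith), Real.sqrt_le_sqrt (by nlinarith)⟩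
  -- the drift at time `1`
  have hVm : Measurable fun y : PhaseSpace N => ENNReal.ofReal (Real.exp (θ * P.hamiltonian N y)) :=
    ENNReal.measurable_ofReal.comp (Real.measurable_exp.comp
      ((pinnedChain_continuous_hamiltonian ω₂ lam β γ N).measurable.const_mul _))
  have hdrift : ∀ x : PhaseSpace N,
      ∫⁻ y, ENNReal.ofReal (Real.exp (θ * P.hamiltonian N y)) ∂(P.transitionKernel N T_L T_R 1 x) ≤
        ENNReal.ofReal (1 / 2) * ENNReal.ofReal (Real.exp (θ * P.hamiltonian N x)) + ENNReal.ofReal b := by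
    intro x
    by_cases hx : P.hamiltonian N x ≤ E₀
    · refine (lintegral_exp_mul_hamiltonian_pinnedChainSemigroup_le hω hl.le hβ.le hγ.le hN0 hTL0.le hTR0.le
        hTL0 hTR0 hθ0 hθ'τ 1 x).trans (le_add_left (ENNReal.ofReal_le_ofReal ?_))
      rw [hb, NNReal.coe_one, mul_one]
      exact mul_le_mul (Real.exp_le_exp.2 hΛτ) (Real.exp_le_exp.2 (mul_le_mul_of_nonneg_left hx hθ0.le))
        (Real.exp_pos _).le (Real.exp_pos _).le
    · rw [pinnedChain_lintegral_transitionKernel hω hl.le hβ.le hγ.le N T_L T_R 1 x hVm]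
      refine (hE₀ T_L T_R hTL0 hTR0 hTLle hTRle x (le_of_not_ge hx)).trans (le_add_right (le_of_eq ?_))
      rw [← ENNReal.ofReal_mul (by norm_num)]
      congr 1; ring
  -- the minorisation on `{e^{θH} ≤ R} ⊆ {H ≤ log R / θ}`
  obtain ⟨ν, hν, hνmin⟩ := hmin T_L T_R (hamp T_L hTLge hTLle).1 (hamp T_L hTLge hTLle).2
    (hamp T_R hTRge hTRle).1 (hamp T_R hTRge hTRle).2
  have hmin' : ∃ ν : Measure (PhaseSpace N), IsProbabilityMeasure ν ∧ ∀ x : PhaseSpace N,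
      Real.exp (θ * P.hamiltonian N x) ≤ (2 * (b / (1 - 1 / 2)) + 1) / (1 - 1 / 2) →
        ENNReal.ofReal α • ν ≤ P.transitionKernel N T_L T_R (m : ℝ≥0) x := by
    refine ⟨ν, hν, fun x hx => hνmin x ?_⟩
    rw [le_div_iff₀ hθ0, mul_comm]
    exact (Real.le_log_iff_exp_le hRr0).2 hx
  exact h25 T_L T_R hTL0 hTR0 hθ'τ hΛτ hdrift hmin' μ hμ hinv z t f hf hfb

/-- **Stub S2a · uniformAsymmetryTransfer (UA), PROVED.** For all parameters `> 0`, `T > 0`, every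
length `N` and THE unique deterministic weak steady family `μ0`: there are `K, ε₀ > 0, δ₀ > 0`
such that for all `0 < |δ| < δ₀`, every `A ≥ 0` bounding the flip-odd part of
`μ0 (T+δ/2) (T-δ/2)` on continuous `|h| ≤ e^{θ_δ H}` (`θ_δ = 1/(2 max(T+δ/2, T-δ/2))`), and every
rate `ε ∈ (0, ε₀]`, SOME weak flip steady state `μ` of `L + εS` at `(T+δ/2, T-δ/2)` has
`|totalCurrent μ - totalCurrent (μ0 (T+δ/2) (T-δ/2))| ≤ K ε A`. Proof: (UEC)
(`uniformExpConvergence`) fed into `uniformAsymmetryTransfer_of_uniformExpConvergence`; for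
`N ≤ 1` both currents vanish (the point mass, resp. the Gibbs measure at the mean temperature, is a
flip steady state). -/
theorem stub_uniformAsymmetryTransfer :
    ∀ ω₂ lam β γ : ℝ, 0 < ω₂ → 0 < lam → 0 < β → 0 < γ → ∀ T : ℝ, 0 < T → ∀ N : ℕ,
      ∀ μ0 : ℝ → ℝ → Measure (PhaseSpace N),
        (∀ T_L T_R : ℝ, 0 < T_L → 0 < T_R →
          (pinnedChain ω₂ lam β γ).IsSteadyState N T_L T_R (μ0 T_L T_R) ∧
            ∀ ν : Measure (PhaseSpace N),
              (pinnedChain ω₂ lam β γ).IsSteadyState N T_L T_R ν → ν = μ0 T_L T_R) →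
        ∃ K ε₀ δ₀ : ℝ, 0 < ε₀ ∧ 0 < δ₀ ∧ ∀ δ : ℝ, δ ≠ 0 → |δ| < δ₀ → ∀ A : ℝ, 0 ≤ A →
          (∀ (i : Fin N) (h : PhaseSpace N → ℝ), Continuous h →
            (∀ y, |h y| ≤ Real.exp (1 / max (T + δ / 2) (T - δ / 2) / 2 *
              (pinnedChain ω₂ lam β γ).hamiltonian N y)) →
            |∫ y, h (momentumFlip i y) ∂(μ0 (T + δ / 2) (T - δ / 2)) -
                ∫ y, h y ∂(μ0 (T + δ / 2) (T - δ / 2))| ≤ A) →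
          ∀ ε : ℝ, 0 < ε → ε ≤ ε₀ →
            ∃ μ : Measure (PhaseSpace N),
              (pinnedChain ω₂ lam β γ).IsFlipSteadyState N (T + δ / 2) (T - δ / 2) ε μ ∧
                |(pinnedChain ω₂ lam β γ).totalCurrent μ -
                    (pinnedChain ω₂ lam β γ).totalCurrent (μ0 (T + δ / 2) (T - δ / 2))| ≤ K * ε * A := by
  intro ω₂ lam β γ hω hl hβ hγ T hT N μ0 hμ0
  set P := pinnedChain ω₂ lam β γ with hPdef
  rcases Nat.lt_or_ge N 2 with hN2 | hN2
  · -- no bond: both currents vanish; a flip steady state exists (`N = 0`: point mass; `N = 1`: Gibbs)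
    refine ⟨0, 1, T, one_pos, hT, fun δ _ hδ A hA _ ε hε _ => ?_⟩
    have h1 := abs_lt.1 hδ
    have hTL : 0 < T + δ / 2 := by linarith
    have hTR : 0 < T - δ / 2 := by linarith
    obtain ⟨μ, hμ⟩ : ∃ μ : Measure (PhaseSpace N), P.IsFlipSteadyState N (T + δ / 2) (T - δ / 2) ε μ := by
      interval_cases N
      · exact ⟨Measure.dirac default, P.isFlipSteadyState_zero_sites _ _ ε⟩
      · exact ⟨_, pinnedChain_isFlipSteadyState_gibbsMeasure_one hω hl.le hβ.le γ hTL hTR ε⟩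
    refine ⟨μ, hμ, ?_⟩
    rw [totalCurrent_eq_zero_of_le_one P (by omega) μ,
      totalCurrent_eq_zero_of_le_one P (by omega) (μ0 _ _), sub_zero, abs_zero, zero_mul, zero_mul]
  exact uniformAsymmetryTransfer_of_uniformExpConvergence hω hl hβ hγ hT N μ0 hμ0
    (uniformExpConvergence hω hl hβ hγ hN2 hT)

end Summit.AtomisticToContinuum.FouriersLaw.Theorems.FixedLengthNoiseContinuity

end
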